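import Mathlib
import Summits.Ventures.PercRepro2.RowC1DetHFresh

/-!
# Positive association of the cluster of `a₂` for monotone functionals, conditionally on `a₁ ↮ X`
(blind cell PercRepro2, p2 g31; proofs/P2-G31-DETH.md §6 — the «always» comparisons)

For an avoidance set `X ∋ a₂`, `R_X = {a₁ ↮ x, x ∈ X}`, and monotone functionals `Φ, Ψ` of the cluster of
`a₂` bounded by `1`:

  `E[Φ(C₂) 1_{R_X}]·E[Ψ(C₂) 1_{R_X}] ≤ E[Φ(C₂) Ψ(C₂) 1_{R_X}]·P(R_X)`   (`condPA_fun_a₂`).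

With `Ψ = 1[v ∈ ·]` this is `CondPA.lean` for functionals: e.g. for `Φ = q₂` (an increasing attachment
probability of the cluster of `a₂`) and `X = {a₂, b}` it says `E[q₂ | b ∈ C₂] ≥ E[q₂ | b ∉ C₁ ∪ C₂]`.

Proof: explore `K = C(a₁)`; on `R_X` the cluster of `a₂` is its cluster in `G ∖ K`, so
`E[Φ(C₂) 1_{R_X}] = E[Φ̂(K) 1_{R_X}]` with `Φ̂(K) = E_{G∖K}[Φ(C(a₂))]` (`freshFun`, the tower identity
`expect_pair_mul_indicator`); Harris in `G ∖ K` gives `(ΦΨ)^(K) ≥ Φ̂(K) Ψ̂(K)`; `Φ̂, Ψ̂` are antitone in `K`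
with values in `[0, 1]`, so `bhk_induced` for the cluster of `a₁` with the avoidance set `X` and the
monotone functionals `1 − Φ̂`, `1 − Ψ̂` closes the argument.  Std axioms.
-/

namespace Summit.Ventures.PercRepro2

namespace RowC1

section CondPAFun

open Classical

variable {V : Type*} {E : Type*} [Fintype E] [DecidableEq E] [Fintype V] [DecidableEq V]
  {R : Type*} [CommRing R] [LinearOrder R] [IsStrictOrderedRing R]

/-- `Φ̂(K) = E_{G∖K}[Φ(C(a₂))]`: the fresh expectation of a cluster functional of `a₂` after closing
every edge at `K`. -/
noncomputable def freshFun (p : E → R) (ends : E → Sym2 V) (a₂ : V) (Φ : Set V → R) (K : Set V) : R :=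
  expect p (fun ω => Φ (cluster ends (delConfig ends K ω) a₂))

omit [Fintype V] [DecidableEq V] in
/-- `Φ̂` is antitone in `K` for monotone `Φ`. -/
lemma freshFun_anti (p : E → R) (hp : IsProbVec p) (ends : E → Sym2 V) (a₂ : V) {Φ : Set V → R}
    (hΦ : Monotone Φ) : Antitone (freshFun p ends a₂ Φ) := by
  intro K K' h
  unfold freshFun
  exact expect_mono hp fun ω => hΦ (cluster_mono (delConfig_anti h ω) a₂)

omit [Fintype V] [DecidableEq V] in
/-- `0 ≤ Φ̂` for nonnegative `Φ`. -/
lemma freshFun_nonneg (p : E → R) (hp : IsProbVec p) (ends : E → Sym2 V) (a₂ : V) {Φ : Set V → R}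
    (hΦ0 : ∀ C, 0 ≤ Φ C) (K : Set V) : 0 ≤ freshFun p ends a₂ Φ K :=
  expect_nonneg hp fun _ => hΦ0 _

omit [Fintype V] [DecidableEq V] in
/-- `Φ̂ ≤ 1` for `Φ ≤ 1`. -/
lemma freshFun_le_one (p : E → R) (hp : IsProbVec p) (ends : E → Sym2 V) (a₂ : V) {Φ : Set V → R}
    (hΦ1 : ∀ C, Φ C ≤ 1) (K : Set V) : freshFun p ends a₂ Φ K ≤ 1 := by
  unfold freshFun
  have := expect_mono hp (f := fun ω => Φ (cluster ends (delConfig ends K ω) a₂)) (g := fun _ => 1)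
    fun ω => hΦ1 _
  simpa using this

omit [Fintype V] [DecidableEq V] in
/-- **Harris in `G ∖ K`**: `Φ̂(K) Ψ̂(K) ≤ (ΦΨ)^(K)` for monotone `Φ, Ψ`. -/
lemma freshFun_mul_le (p : E → R) (hp : IsProbVec p) (ends : E → Sym2 V) (a₂ : V)
    {Φ Ψ : Set V → R} (hΦ : Monotone Φ) (hΨ : Monotone Ψ) (K : Set V) :
    freshFun p ends a₂ Φ K * freshFun p ends a₂ Ψ K ≤ freshFun p ends a₂ (fun C => Φ C * Ψ C) K := by
  unfold freshFun
  have hf : Monotone (fun ω => Φ (cluster ends (delConfig ends K ω) a₂)) :=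
    fun ω ω' h => hΦ (cluster_mono (BHKPair.delConfig_mono_config ends K h) a₂)
  have hg : Monotone (fun ω => Ψ (cluster ends (delConfig ends K ω) a₂)) :=
    fun ω ω' h => hΨ (cluster_mono (BHKPair.delConfig_mono_config ends K h) a₂)
  have key := expect_mul_expect_le_expect_mul hp hf hg
  refine key.trans (le_of_eq ?_)
  rfl

/-- The family `{K : K ∩ X = ∅}` of clusters avoiding `X` (as in `CondPA.lean`). -/
def avoidFamF (X : Finset V) : Set (Set V) := {K : Set V | ∀ x ∈ X, x ∉ K}

/-- The avoidance indicator `1[C(a₁) avoids X]·1_Q`. -/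
noncomputable def avoidIndF (ends : E → Sym2 V) (a₁ a₂ : V) (X : Finset V) (ω : Config E) : R :=
  (avoidFamF X).indicator 1 (cluster ends ω a₁) * ((connEvent ends a₁ a₂)ᶜ).indicator 1 ω

omit [Fintype E] [DecidableEq E] [Fintype V] [DecidableEq V] in
/-- `0 ≤ I_X`. -/
lemma avoidIndF_nonneg (ends : E → Sym2 V) (a₁ a₂ : V) (X : Finset V) (ω : Config E) :
    (0 : R) ≤ avoidIndF ends a₁ a₂ X ω :=
  mul_nonneg (Set.indicator_apply_nonneg fun _ => zero_le_one)
    (Set.indicator_apply_nonneg fun _ => zero_le_one)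

omit [Fintype E] [DecidableEq E] [DecidableEq V] [LinearOrder R] [IsStrictOrderedRing R] in
/-- With `a₂ ∈ X`, `I_X` is the indicator of `R_X`. -/
lemma REvent_indicator_eq_avoidIndF (ends : E → Sym2 V) (a₁ a₂ : V) (X : Finset V) (ha₂ : a₂ ∈ X)
    (ω : Config E) :
    (REvent ends Finset.univ a₁ X).indicator (1 : Config E → R) ω = avoidIndF ends a₁ a₂ X ω := by
  unfold avoidIndF
  have hR : ω ∈ REvent ends Finset.univ a₁ X ↔ cluster ends ω a₁ ∈ avoidFamF X := by
    simp only [REvent, Finset.coe_univ, induced_univ, Set.mem_setOf_eq, avoidFamF, mem_cluster]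
  by_cases h : ω ∈ REvent ends Finset.univ a₁ X
  · have hU : cluster ends ω a₁ ∈ avoidFamF X := hR.1 h
    have hQ : ω ∈ (connEvent ends a₁ a₂)ᶜ := fun hc => hU a₂ ha₂ hc
    rw [Set.indicator_of_mem h, Set.indicator_of_mem hU, Set.indicator_of_mem hQ]
    simp
  · have hU : cluster ends ω a₁ ∉ avoidFamF X := fun hU => h (hR.2 hU)
    rw [Set.indicator_of_notMem h, Set.indicator_of_notMem hU, zero_mul]

omit [Fintype E] [DecidableEq E] [DecidableEq V] [LinearOrder R] [IsStrictOrderedRing R] in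
/-- The pointwise form `Φ(C₂)·1_{R_X} = 1_𝓤(C₁)·Φ(C₂)·1_Q` needed for the tower identity. -/
lemma indicator_REvent_mul (ends : E → Sym2 V) (a₁ a₂ : V) (X : Finset V) (ha₂ : a₂ ∈ X)
    (Φ : Set V → R) (ω : Config E) :
    Φ (cluster ends ω a₂) * (REvent ends Finset.univ a₁ X).indicator (1 : Config E → R) ω =
      ((avoidFamF X).indicator 1 (cluster ends ω a₁) * Φ (cluster ends ω a₂)) *
        ((connEvent ends a₁ a₂)ᶜ).indicator 1 ω := by
  rw [REvent_indicator_eq_avoidIndF ends a₁ a₂ X ha₂]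
  unfold avoidIndF
  ring

omit [DecidableEq V] [LinearOrder R] [IsStrictOrderedRing R] in
/-- **The tower identity for `Φ(C₂) 1_{R_X}`**: `E[Φ(C₂) 1_{R_X}] = E[Φ̂(C₁) I_X]`. -/
theorem expect_fun_REvent (p : E → R) (ends : E → Sym2 V) (a₁ a₂ : V) (X : Finset V) (ha₂ : a₂ ∈ X)
    (Φ : Set V → R) :
    expect p (fun ω => Φ (cluster ends ω a₂) * (REvent ends Finset.univ a₁ X).indicator 1 ω) =
      expect p (fun ω => freshFun p ends a₂ Φ (cluster ends ω a₁) * avoidIndF ends a₁ a₂ X ω) := by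
  have e1 : (fun ω => Φ (cluster ends ω a₂) * (REvent ends Finset.univ a₁ X).indicator 1 ω) =
      fun ω => ((avoidFamF X).indicator 1 (cluster ends ω a₁) * Φ (cluster ends ω a₂)) *
        ((connEvent ends a₁ a₂)ᶜ).indicator 1 ω :=
    funext fun ω => indicator_REvent_mul ends a₁ a₂ X ha₂ Φ ω
  rw [e1]
  have t := BHKPair.expect_pair_mul_indicator p ends a₁ a₂
    (fun W C => (avoidFamF X).indicator 1 W * Φ C)
  rw [t]
  refine congrArg (expect p) (funext fun ω => ?_)
  unfold avoidIndF freshFun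
  rw [expect_const_mul]
  ring

/-- **The BHK step**: `E[Φ̂ I]·E[Ψ̂ I] ≤ E[Φ̂ Ψ̂ I]·E[I]` for antitone `Φ̂, Ψ̂ ∈ [0, 1]`. -/
theorem bhk_fun_step (p : E → R) (hp : IsProbVec p) (ends : E → Sym2 V) (a₁ a₂ : V) (X : Finset V)
    (ha₂ : a₂ ∈ X) {Φ Ψ : Set V → R} (hΦ : Monotone Φ) (hΨ : Monotone Ψ)
    (hΦ1 : ∀ C, Φ C ≤ 1) (hΨ1 : ∀ C, Ψ C ≤ 1) :
    expect p (fun ω => freshFun p ends a₂ Φ (cluster ends ω a₁) * avoidIndF ends a₁ a₂ X ω) *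
        expect p (fun ω => freshFun p ends a₂ Ψ (cluster ends ω a₁) * avoidIndF ends a₁ a₂ X ω) ≤
      expect p (fun ω => freshFun p ends a₂ Φ (cluster ends ω a₁) *
          freshFun p ends a₂ Ψ (cluster ends ω a₁) * avoidIndF ends a₁ a₂ X ω) *
        expect p (fun ω => avoidIndF ends a₁ a₂ X ω) := by
  have hF₁ : Monotone (fun K : Set V => 1 - freshFun p ends a₂ Φ K) :=
    fun K K' h => sub_le_sub_left (freshFun_anti p hp ends a₂ hΦ h) 1
  have hF₂ : Monotone (fun K : Set V => 1 - freshFun p ends a₂ Ψ K) :=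
    fun K K' h => sub_le_sub_left (freshFun_anti p hp ends a₂ hΨ h) 1
  have hF₁0 : ∀ K : Set V, 0 ≤ 1 - freshFun p ends a₂ Φ K :=
    fun K => sub_nonneg.2 (freshFun_le_one p hp ends a₂ hΦ1 K)
  have hF₂0 : ∀ K : Set V, 0 ≤ 1 - freshFun p ends a₂ Ψ K :=
    fun K => sub_nonneg.2 (freshFun_le_one p hp ends a₂ hΨ1 K)
  have h := bhk_induced p hp ends a₁ hF₁ hF₂ hF₁0 hF₂0 Finset.univ X X
    (Finset.subset_univ _) (Finset.subset_univ _)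
  simp only [Finset.inter_self, Finset.union_self] at h
  have e1 : ∀ F : Set V → R, clusterObs ends Finset.univ a₁ F *
      (REvent ends Finset.univ a₁ X).indicator 1 =
      fun ω => F (cluster ends ω a₁) * avoidIndF ends a₁ a₂ X ω := by
    intro F
    funext ω
    simp only [Pi.mul_apply, clusterObs_apply, clusterIn_univ,
      REvent_indicator_eq_avoidIndF ends a₁ a₂ X ha₂]
  have e2 : prob p (REvent ends Finset.univ a₁ X) =
      expect p (fun ω => avoidIndF ends a₁ a₂ X ω) := by
    rw [prob_eq_expect_indicator]
    unfold expect
    refine Finset.sum_congr rfl fun ω _ => ?_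
    rw [REvent_indicator_eq_avoidIndF ends a₁ a₂ X ha₂]
  rw [e1, e1, e1, e2] at h
  simp only [Pi.mul_apply] at h
  have ef : expect p (fun ω => (1 - freshFun p ends a₂ Φ (cluster ends ω a₁)) *
      avoidIndF ends a₁ a₂ X ω) = expect p (fun ω => avoidIndF ends a₁ a₂ X ω) -
      expect p (fun ω => freshFun p ends a₂ Φ (cluster ends ω a₁) * avoidIndF ends a₁ a₂ X ω) :=
    expect_one_sub_mul p _ _
  have eg : expect p (fun ω => (1 - freshFun p ends a₂ Ψ (cluster ends ω a₁)) *
      avoidIndF ends a₁ a₂ X ω) = expect p (fun ω => avoidIndF ends a₁ a₂ X ω) -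
      expect p (fun ω => freshFun p ends a₂ Ψ (cluster ends ω a₁) * avoidIndF ends a₁ a₂ X ω) :=
    expect_one_sub_mul p _ _
  have efg : expect p (fun ω => (1 - freshFun p ends a₂ Φ (cluster ends ω a₁)) *
      (1 - freshFun p ends a₂ Ψ (cluster ends ω a₁)) * avoidIndF ends a₁ a₂ X ω) =
      expect p (fun ω => avoidIndF ends a₁ a₂ X ω) -
      expect p (fun ω => freshFun p ends a₂ Φ (cluster ends ω a₁) * avoidIndF ends a₁ a₂ X ω) -
      expect p (fun ω => freshFun p ends a₂ Ψ (cluster ends ω a₁) * avoidIndF ends a₁ a₂ X ω) +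
      expect p (fun ω => freshFun p ends a₂ Φ (cluster ends ω a₁) *
        freshFun p ends a₂ Ψ (cluster ends ω a₁) * avoidIndF ends a₁ a₂ X ω) :=
    expect_one_sub_mul_one_sub_mul p _ _ _
  rw [ef, eg, efg] at h
  nlinarith [h]

/-- **Conditional positive association of the cluster of `a₂` for monotone functionals**: for
`X ∋ a₂` and monotone `Φ, Ψ : Set V → R` bounded by `1`,
`E[Φ(C₂) 1_{R_X}]·E[Ψ(C₂) 1_{R_X}] ≤ E[Φ(C₂)Ψ(C₂) 1_{R_X}]·P(R_X)`. -/
theorem condPA_fun_a₂ (p : E → R) (hp : IsProbVec p) (ends : E → Sym2 V) (a₁ a₂ : V) (X : Finset V)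
    (ha₂ : a₂ ∈ X) {Φ Ψ : Set V → R} (hΦ : Monotone Φ) (hΨ : Monotone Ψ)
    (hΦ1 : ∀ C, Φ C ≤ 1) (hΨ1 : ∀ C, Ψ C ≤ 1) :
    expect p (fun ω => Φ (cluster ends ω a₂) * (REvent ends Finset.univ a₁ X).indicator 1 ω) *
        expect p (fun ω => Ψ (cluster ends ω a₂) * (REvent ends Finset.univ a₁ X).indicator 1 ω) ≤
      expect p (fun ω => Φ (cluster ends ω a₂) * Ψ (cluster ends ω a₂) *
          (REvent ends Finset.univ a₁ X).indicator 1 ω) *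
        prob p (REvent ends Finset.univ a₁ X) := by
  rw [expect_fun_REvent p ends a₁ a₂ X ha₂ Φ, expect_fun_REvent p ends a₁ a₂ X ha₂ Ψ]
  have e3 : expect p (fun ω => Φ (cluster ends ω a₂) * Ψ (cluster ends ω a₂) *
      (REvent ends Finset.univ a₁ X).indicator 1 ω) =
      expect p (fun ω => freshFun p ends a₂ (fun C => Φ C * Ψ C) (cluster ends ω a₁) *
        avoidIndF ends a₁ a₂ X ω) :=
    expect_fun_REvent p ends a₁ a₂ X ha₂ (fun C => Φ C * Ψ C)
  rw [e3]
  have e2 : prob p (REvent ends Finset.univ a₁ X) =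
      expect p (fun ω => avoidIndF ends a₁ a₂ X ω) := by
    rw [prob_eq_expect_indicator]
    unfold expect
    refine Finset.sum_congr rfl fun ω _ => ?_
    rw [REvent_indicator_eq_avoidIndF ends a₁ a₂ X ha₂]
  rw [e2]
  have key := bhk_fun_step p hp ends a₁ a₂ X ha₂ hΦ hΨ hΦ1 hΨ1
  have hA : expect p (fun ω => freshFun p ends a₂ Φ (cluster ends ω a₁) *
        freshFun p ends a₂ Ψ (cluster ends ω a₁) * avoidIndF ends a₁ a₂ X ω) ≤
      expect p (fun ω => freshFun p ends a₂ (fun C => Φ C * Ψ C) (cluster ends ω a₁) *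
        avoidIndF ends a₁ a₂ X ω) :=
    expect_mono hp fun ω => mul_le_mul_of_nonneg_right
      (freshFun_mul_le p hp ends a₂ hΦ hΨ _) (avoidIndF_nonneg ends a₁ a₂ X ω)
  have nI : 0 ≤ expect p (fun ω => avoidIndF ends a₁ a₂ X ω) :=
    expect_nonneg hp fun ω => avoidIndF_nonneg ends a₁ a₂ X ω
  calc _ ≤ _ := key
    _ ≤ _ := mul_le_mul_of_nonneg_right hA nI

end CondPAFun

end RowC1

end Summit.Ventures.PercRepro2
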